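import Literature.AnabelianGeometry.AbsoluteAnabelian.GaloisPadicLogShellBridge
import Summits.ABC.IUTFork.LanaLogLinkFrobeniusIntegers
import HarnessLib

/-!
# L-LANA objects VI quater: the printed log-shell `I_v` and `O_v ⊂ I_v` for EVERY `p`-adic field `K_v = E ⊆ ℚ̄_p`

Record-only file (D-0012; seat abc-iut-c312-4, L-LANA level, plan/LLANA-SPEC N10) generalising
`LanaLogLinkFrobenius.lean` / `…Integers.lean` (the case `K_v = ℚ_p`) to an ARBITRARY finite extension `E` of `ℚ_p`
inside `ℚ̄_p` — the setting "`k_i ⊆ ℚ̄_p`" of [IUTchIV] Prop. 1.1 in which every nonarchimedean completion `K_v` of a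
number field is realised; TAKES NO SIDE on [IUTchIII] Cor. 3.12. The reference datum: `K̄_v = ℚ̄_p`,
`G_v = Gal(ℚ̄_p/E)` (`PadicAlgCl p ≃ₐ[E] PadicAlgCl p`, acting isometrically: `isValPreserving_subfield`), LANA's
`O^×`, `O^{×μ}`, `I^κ_H`, `(O^×)^{G_v}` from `LanaLocalUnits.lean`, the (MF) log-shell `logShellMF` from `LanaLogShell.lean`,
and the REAL `log : O^{×μ}_{ℚ̄_p} ⥲ ℚ̄_p` (`padicLogIso`, L4's Iwasawa logarithm) from `LanaLogLinkFrobenius.lean`.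

LANA §5.1 p. 26: "`I_v = (2p_v)⁻¹ · Im(O^×_v ↪ O^×_{K̄_v} ↠ O^{×μ}_v →^{log} K̄_v) ⊂ K̄_v`; note that the factor `(2p_v)⁻¹`
makes the inclusion `O_v ⊂ I_v` to hold"; §5.1 (c) p. 27: "`I_v(F^{⊢×μ}) = (2p_v)⁻¹ · Im(I^κ_{G_v} ↪ O^{×μ}_v)`".

* `padicLogIso_smul_subfield` — `log` is `Gal(ℚ̄_p/E)`-equivariant;
* `printedLogShellOf E` — **`I_v ⊂ ℚ̄_p` as displayed, for `K_v = E`** (`(2p)⁻¹ · log((O^×_{ℚ̄_p})^{Gal(ℚ̄_p/E)})`);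
* **`padicLogIso_mem_printedLogShellOf_iff` (PROVED)** — the (MF) log-shell for `G_v = Gal(ℚ̄_p/E)` maps ONTO `I_v`
  under `log` (`map_logShellMF_subfield_eq`);
* `unitInv_subfield_iff` — `(O^×_{ℚ̄_p})^{Gal(ℚ̄_p/E)} = O^×_E` (the invariant units are exactly the `E`-rational ones:
  Galois correspondence `InfiniteGalois.mem_range_algebraMap_iff_fixed`);
* **`coe_mem_printedLogShellOf` (PROVED)** — **`O_E ⊆ I_v`** ("the factor `(2p_v)⁻¹` makes `O_v ⊂ I_v` hold"), from
  abc-iut-S1/L3-t11's `closedBall_subset_smul_logUnits` for `E` ([AbsTopIII] Def. 5.4 (iii): `𝒪_E ⊆ (p*)⁻¹·log_p(𝒪_E^×)`),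
  abc-iut-S1's `coe_unitLog_eq_padicLogAlgCl`, and `2p = p*·(1 or 2)`.

HONEST SCOPE: model inside a fixed `ℚ̄_p` (LANA's `K̄_v` for `v | p`); the archimedean places and the field structure
"`K̄_v(logF)`" are not touched. [cite: LANA2026Report, §5.1 pp. 26–27] [cite: MochizukiAbsTopIII2015, Def 5.4 (iii) p. 126]
NOT here: any judgement.
-/

noncomputable section

namespace Summit.ABC
namespace IUTFork

open Literature.AnabelianGeometry.AbsoluteAnabelian Literature.IUT.LogVolume
open Literature.NumberTheory.Transcendental (padicLogAlgCl)
open scoped NNReal Pointwise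

variable (p : ℕ) [Fact p.Prime] (E : IntermediateField ℚ_[p] (PadicAlgCl p))

/-! ## 1. `G_v = Gal(ℚ̄_p/E)` acts isometrically; `log` is `G_v`-equivariant -/

/-- `Gal(ℚ̄_p/E)` preserves `| · |` on `ℚ̄_p` (it sits inside `Gal(ℚ̄_p/ℚ_p)`, which is isometric: `norm_galois`) —
the instance making LANA's `O^×`, `O^{×μ}`, `I^κ_H` available for `G_v = Gal(ℚ̄_p/E)`. [cite: LANA2026Report, §3.5 p. 19] -/
instance isValPreserving_subfield : IsValPreserving (padicVal p) (PadicAlgCl p ≃ₐ[E] PadicAlgCl p) where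
  val_smul σ a := by
    have h := norm_galois p (σ.restrictScalars ℚ_[p]) a
    change ‖σ a‖ = ‖a‖ at h
    change Valued.v (σ a) = Valued.v a
    rw [PadicAlgCl.valuation_def, PadicAlgCl.valuation_def, ← NNReal.coe_inj, coe_nnnorm, coe_nnnorm]
    exact h

/-- **`Gal(ℚ̄_p/E)`-equivariance of `log : O^{×μ} ⥲ ℚ̄_p`** (from the `Gal(ℚ̄_p/ℚ_p)`-equivariance `padicLogIso_smul`).
[cite: LANA2026Report, §5.1 p. 26] -/
theorem padicLogIso_smul_subfield (σ : PadicAlgCl p ≃ₐ[E] PadicAlgCl p) (y : UnitsModTorsion (padicVal p)) :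
    Multiplicative.toAdd (padicLogIso p (σ • y)) = σ (Multiplicative.toAdd (padicLogIso p y)) := by
  have h := padicLogIso_smul p (σ.restrictScalars ℚ_[p]) y
  induction y using QuotientGroup.induction_on with
  | H u => exact h

/-! ## 2. The printed log-shell for `K_v = E` and the (MF) log-shell under `log` -/

/-- **LANA p. 26 for `K_v = E ⊆ ℚ̄_p`: `I_v := (2p)⁻¹ · log((O^×_{ℚ̄_p})^{Gal(ℚ̄_p/E)}) ⊂ ℚ̄_p`**.
[cite: LANA2026Report, §5.1 p. 26] -/
def printedLogShellOf : AddSubgroup (PadicAlgCl p) where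
  carrier := {y | ∃ u ∈ unitInv (padicVal p) (PadicAlgCl p ≃ₐ[E] PadicAlgCl p),
    ((2 * p : ℕ) : PadicAlgCl p) * y = padicLogAlgCl p ((u : (PadicAlgCl p)ˣ) : PadicAlgCl p)}
  zero_mem' := ⟨1, Subgroup.one_mem _, by
    rw [mul_zero]
    exact (congrArg Multiplicative.toAdd (map_one (padicLogUnits p))).symm⟩
  add_mem' := by
    rintro a b ⟨u, hu, hau⟩ ⟨v, hv, hbv⟩
    refine ⟨u * v, Subgroup.mul_mem _ hu hv, ?_⟩
    have h := congrArg Multiplicative.toAdd (map_mul (padicLogUnits p) u v)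
    rw [padicLogUnits_apply, padicLogUnits_apply, padicLogUnits_apply, toAdd_ofAdd, toAdd_mul, toAdd_ofAdd,
      toAdd_ofAdd] at h
    rw [mul_add, hau, hbv, ← h]
  neg_mem' := by
    rintro a ⟨u, hu, hau⟩
    refine ⟨u⁻¹, Subgroup.inv_mem _ hu, ?_⟩
    have h := congrArg Multiplicative.toAdd (map_inv (padicLogUnits p) u)
    rw [padicLogUnits_apply, padicLogUnits_apply, toAdd_ofAdd, toAdd_inv, toAdd_ofAdd] at h
    rw [mul_neg, hau, ← h]

/-- Membership in `I_v` for `K_v = E`. [cite: LANA2026Report, §5.1 p. 26] -/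
theorem mem_printedLogShellOf_iff (y : PadicAlgCl p) :
    y ∈ printedLogShellOf p E ↔ ∃ u ∈ unitInv (padicVal p) (PadicAlgCl p ≃ₐ[E] PadicAlgCl p),
      ((2 * p : ℕ) : PadicAlgCl p) * y = padicLogAlgCl p ((u : (PadicAlgCl p)ˣ) : PadicAlgCl p) :=
  Iff.rfl

/-- **(MF) ⟷ printed `I_v` for `K_v = E` (PROVED)**: `log y ∈ I_v ⟺ y ∈ I_v(F^{⊢×μ}) = {y | y^{2p} ∈ I^κ_{G_v}}`.
[cite: LANA2026Report, §5.1 p. 26, §5.1 (c) p. 27] -/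
theorem padicLogIso_mem_printedLogShellOf_iff (y : UnitsModTorsion (padicVal p)) :
    Multiplicative.toAdd (padicLogIso p y) ∈ printedLogShellOf p E ↔
      y ∈ logShellMF (padicVal p) (PadicAlgCl p ≃ₐ[E] PadicAlgCl p) p := by
  rw [mem_logShellMF_iff, mem_kummerStructure_iff, mem_printedLogShellOf_iff]
  constructor
  · rintro ⟨u, hu, h⟩
    refine ⟨u, hu, ?_⟩
    apply (padicLogIso p).injective
    apply Multiplicative.toAdd.injective
    rw [toAdd_padicLogIso_pow, h, padicLogIso_mk, toAdd_ofAdd]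
  · rintro ⟨u, hu, h⟩
    refine ⟨u, hu, ?_⟩
    rw [← toAdd_padicLogIso_pow, ← h, padicLogIso_mk, toAdd_ofAdd]

/-- Set-level form: `log(I_v(F^{⊢×μ})) = I_v` for `K_v = E`. [cite: LANA2026Report, §5.1 p. 26, §5.1 (c) p. 27] -/
theorem map_logShellMF_subfield_eq :
    (fun y => Multiplicative.toAdd (padicLogIso p y)) ''
        (logShellMF (padicVal p) (PadicAlgCl p ≃ₐ[E] PadicAlgCl p) p : Set _) =
      (printedLogShellOf p E : Set (PadicAlgCl p)) := by
  ext z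
  constructor
  · rintro ⟨y, hy, rfl⟩
    exact (padicLogIso_mem_printedLogShellOf_iff p E y).mpr hy
  · intro hz
    obtain ⟨y, hy⟩ := (padicLogIso p).surjective (Multiplicative.ofAdd z)
    refine ⟨y, ?_, ?_⟩
    · rw [SetLike.mem_coe, ← padicLogIso_mem_printedLogShellOf_iff, hy, toAdd_ofAdd]
      exact hz
    · change Multiplicative.toAdd (padicLogIso p y) = z
      rw [hy, toAdd_ofAdd]

/-! ## 3. `(O^×_{ℚ̄_p})^{G_v} = O^×_E` and `O_E ⊆ I_v` -/

/-- **`(O^×_{ℚ̄_p})^{Gal(ℚ̄_p/E)} = O^×_E`**: a valuation-one unit is `Gal(ℚ̄_p/E)`-invariant iff it is `E`-rational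
(Galois correspondence for the Galois extension `ℚ̄_p/E`). LANA §3.9: "`O^×_v := (O^×_{K̄_v})^{G_v}`".
[cite: LANA2026Report, §3.9 p. 21] -/
theorem unitInv_subfield_iff (u : unitGrp (padicVal p)) :
    u ∈ unitInv (padicVal p) (PadicAlgCl p ≃ₐ[E] PadicAlgCl p) ↔ ((u : (PadicAlgCl p)ˣ) : PadicAlgCl p) ∈ E := by
  haveI := PadicAlgCl.isAlgClosure_subfield (p := p) E
  haveI : IsGalois E (PadicAlgCl p) := {}
  rw [unitInv, mem_unitInvariants_iff]
  constructor
  · intro h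
    have hfix : ∀ σ : PadicAlgCl p ≃ₐ[E] PadicAlgCl p,
        σ ((u : (PadicAlgCl p)ˣ) : PadicAlgCl p) = ((u : (PadicAlgCl p)ˣ) : PadicAlgCl p) := by
      intro σ
      have h1 := congrArg (fun v : unitGrp (padicVal p) => ((v : (PadicAlgCl p)ˣ) : PadicAlgCl p))
        (h ⟨σ, Subgroup.mem_top σ⟩)
      simpa only [unitGrp.coe_smul, AlgEquiv.smul_def] using h1
    obtain ⟨e, he⟩ := (InfiniteGalois.mem_range_algebraMap_iff_fixed _).mpr hfix
    rw [← he]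
    exact e.2
  · intro hu σ
    apply Subtype.ext
    apply Units.ext
    rw [unitGrp.coe_smul, AlgEquiv.smul_def]
    exact (σ : PadicAlgCl p ≃ₐ[E] PadicAlgCl p).commutes ⟨_, hu⟩

variable [FiniteDimensional ℚ_[p] E]

/-- **LANA p. 26, "the factor `(2p_v)⁻¹` makes the inclusion `O_v ⊂ I_v` to hold" — PROVED for every finite
`K_v = E ⊆ ℚ̄_p`**: every `x ∈ O_E` (`‖x‖ ≤ 1`) lies in `I_v`. [cite: LANA2026Report, §5.1 p. 26]
[cite: MochizukiAbsTopIII2015, Def 5.4 (iii) p. 126] -/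
theorem coe_mem_printedLogShellOf (x : E) (hx : ‖x‖ ≤ 1) : (x : PadicAlgCl p) ∈ printedLogShellOf p E := by
  have hxE : x ∈ Metric.closedBall (0 : E) 1 := by rwa [Metric.mem_closedBall, dist_zero_right]
  -- `x ∈ (p*)⁻¹ · log_p(𝒪_E^×)`
  obtain ⟨z, hz, hxz⟩ := Set.mem_smul_set.mp (closedBall_subset_smul_logUnits p E hxE)
  obtain ⟨u, hu1, huz⟩ := mem_logUnits_iff.mp hz
  set ps : ℕ := p ^ (if p = 2 then 2 else 1) with hps
  have hps0 : ((ps : ℕ) : E) ≠ 0 := pstarNat_cast_ne_zero p E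
  have hpx : ((ps : ℕ) : PadicAlgCl p) * (x : PadicAlgCl p) = padicLogAlgCl p (u : PadicAlgCl p) := by
    have h1 : ((ps : ℕ) : E) * x = unitLog u := by
      rw [← hxz, huz, smul_eq_mul, ← mul_assoc, mul_inv_cancel₀ hps0, one_mul]
    have h2 := congrArg (fun e : E => (e : PadicAlgCl p)) h1
    simpa [coe_unitLog_eq_padicLogAlgCl p E hu1] using h2
  -- the invariant unit `U := u ∈ O^×_v` and its power `U^{2p/p*}`
  have hu1' : ‖(u : PadicAlgCl p)‖ = 1 := hu1
  let U : unitGrp (padicVal p) := ⟨_, mem_unitGrp_of_norm_eq_one p hu1'⟩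
  have hUval : ((U : (PadicAlgCl p)ˣ) : PadicAlgCl p) = (u : PadicAlgCl p) := rfl
  have hUinv : U ∈ unitInv (padicVal p) (PadicAlgCl p ≃ₐ[E] PadicAlgCl p) := by
    rw [unitInv_subfield_iff, hUval]; exact u.2
  let n : ℕ := if p = 2 then 1 else 2
  refine ⟨U ^ n, Subgroup.pow_mem _ hUinv n, ?_⟩
  rw [padicLogAlgCl_unitGrp_pow, hUval, ← hpx, ← mul_assoc]
  congr 1
  have h2p : 2 * p = ps * n := two_mul_eq_pstarNat_mul p
  rw [h2p, Nat.cast_mul]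
  exact mul_comm _ _

/-- In particular `1 ∈ I_v`. [cite: LANA2026Report, §5.1 p. 26] -/
theorem one_mem_printedLogShellOf : (1 : PadicAlgCl p) ∈ printedLogShellOf p E := by
  have h := coe_mem_printedLogShellOf p E 1 (by rw [norm_one])
  rwa [OneMemClass.coe_one] at h

end IUTFork

end Summit.ABC

end
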